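import Summits.QuantumFields.YangMills.Theorems.BalabanUVNodesN22W1RelCentredMembersOfDatum
import Literature.MathematicalPhysics.QuantumFieldTheory.Balaban1983to89.B13Term214WindowDilatedUnscaled
import Literature.MathematicalPhysics.QuantumFieldTheory.Balaban1983to89.B13Bound226CentredUnscaled

/-!
# BalabanUVNodes ∕ node N22 = NE9 — THE RELATIVE-DISC CENTRED ROAD, MODULE J10b: THE CENTRED PIECE AND THE LARGE-FIELD MEMBERS OF THE DATUM READ FROM LOCAL GROWTH LETTERS — (S-vertex-T′)ʷ's two datum-level
# inputs (member minus boxed centre ≤ s₀²·W for `P(t) = ∅`; the (2.22) surplus for `P(t) ≠ ∅`), kernel-keyed, the exponential-moment ∕ joint (2.20) letters of J7b ∕ J7a §3 REPLACED by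
# node00-def-W1 W1-12's LOCAL GROWTH vocabulary (dag-n10-c `B13Bound226CentredUnscaled` §5 and `B13Term214WindowDilatedUnscaled` §5 at the datum)

Cell `pub-ymgap`, HUMAN RULING D-0062 (Track A), R134 ACCELERATION re-seat `pub-ymgap-dag-n22-c` (strategy s1), generation 8, file J10b (the LOCAL-GROWTH edition of modules J7b ∕ J7a §3;
lens E6∕E7, this seat's `J10-DESIGN.md` §3–§4).  THEOREMS ONLY; imports J5 `…N22W1RelCentredMembersOfDatum` (the member family; W1-7's datum) and dag-n10-c's
`B13Bound226CentredUnscaled` (v1.2) + `B13Term214WindowDilatedUnscaled` (v1.2) BY NAME.  `--supports` K3⁷ `SpineGivenEndpointR13SepCoPH` (stmt-QuantumFields-20544) as a helper.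

WHY (lens E6∕E7, bus 2026-08-27).  Module J6 read dag-n10-c's window-dilated (2.26)∕holomorphy theorems at the datum with, as located input, the JOINT (2.20) letter of the UNCLIPPED pair
`(s₀⁻²𝒲(φ;Y,s₀·), 𝒪(old,φ;Y,s₀·))` global in the fluctuation field — a letter with NO inhabitant uniform on the real window under the unscaled-field law (the Wilson remainder is cubic).
dag-n10-c's modules 46∕47 re-prove the same conclusions from print-shaped LOCAL growth letters ([II] (1.34)–(1.36), Lemma 2 (1.41)–(1.43), (2.18)–(2.20): per-domain τ-radii, (L0) (ℓ1)
(L4) on the sup-ball `‖A‖ ≤ ρ`, the per-bond multiplicity of the rate weight, the box-support law, `Y`-locality) by clipping INSIDE the proof; node00-def-W1's W1-12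
`TermDatum214.LocalGrowthInputs` types that vocabulary at the datum.  THIS FILE is J7b ∕ J7a §3 re-keyed on those theorems: the centred piece (§3) and the large-field members (§4), binders displayed (generated from
dag-n10-c's binder lists), proofs = one application each.  (J7a §1 box tail, §2 box-free centre and J8's centre need no new reading: their located inputs are local already.)

HONEST FRAMING.  Count-neutral kernel-keyed readings of landed theorems (no estimate proved here); every located input is a HYPOTHESIS (NODE A's kernel letters at the configuration,
W1-12's local growth letters of the potentials, (2.22) for the unscaled-field boxes at `s₀`, the primed letters, the numerics); nothing of Bałaban's asserted; N22 NOT discharged; one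
finite four-torus programme at fixed ε — NOT infinite volume, NOT OS on ℝ⁴, NOT a mass gap, NOT Clay.  0 `sorry`, 0 `def`, standard axioms.

References (TYPES only): [II] = [Balaban1988RG2Cluster] (1.34)–(1.36) p. 9, Lemma 2 (1.41)–(1.43) p. 11, (2.2)–(2.3) p. 12, (2.14)–(2.15) p. 15, (2.16)–(2.22) p. 16, (2.23)–(2.26)
p. 17; [I] = [Balaban1987RG1] §1 p. 263, (2.9)–(2.13) pp. 266–268.
-/

noncomputable section

namespace YMDAG.N22.W1

open Set Metric Matrix
open Literature.MathematicalPhysics.QuantumFieldTheory.Balaban1983to89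
open Literature.MathematicalPhysics.QuantumFieldTheory.Balaban1983to89.B13Term214 (term214 core214 F214)
open Literature.MathematicalPhysics.QuantumFieldTheory.Balaban1983to89.B13Term214WindowDilatedUnscaled (h226_torus_windowDilated_largeField_of_localGrowth_perBond)
open Literature.MathematicalPhysics.QuantumFieldTheory.Balaban1983to89.B13Bound226CentredUnscaled (h226_torus_windowDilated_centred_of_localGrowth_perBond_member)
open Literature.MathematicalPhysics.QuantumFieldTheory.Balaban1983to89.TreeLengthTorus (TPt TDom tsys)
open Literature.MathematicalPhysics.QuantumFieldTheory.Balaban1983to89.B13Lemma3TorusTerms (weight)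
open Literature.MathematicalPhysics.QuantumFieldTheory.Balaban1983to89.B13Bound143 (invTau)
open Literature.MathematicalPhysics.QuantumFieldTheory.Balaban1983to89.B9Thm37GlueTorus (tdist1)
open Literature.MathematicalPhysics.QuantumFieldTheory.Balaban1983to89.B5TorusCover (UT)
open Literature.MathematicalPhysics.QuantumFieldTheory.Balaban1983to89.Node00.Sect2 (domSys domCount CPair)
open Literature.MathematicalPhysics.QuantumFieldTheory.Balaban1983to89.Node00.W1

variable {c₀ : B13.Consts} {P : Params} {𝔸 : Type*} {M k L : ℕ} [NeZero L] (𝔇 : TermDatum214 c₀ P 𝔸 M k L)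
  (χu χcu : (Z : (domSys P M (k + 1)).Dom) → (t : TermLabel P M k L) → ((𝔇.𝒦 Z t).Λ → ℝ) → ℝ)
  (𝒲 : (Z : (domSys P M (k + 1)).Dom) → (t : TermLabel P M k L) → CPair P 𝔸 → TDom P.d (L * domCount P M (k + 1)) → ((𝔇.𝒦 Z t).Λ → ℝ) → ℂ)
  (𝒪 : (Z : (domSys P M (k + 1)).Dom) → (t : TermLabel P M k L) → OlderTerms P 𝔸 M k → CPair P 𝔸 → TDom P.d (L * domCount P M (k + 1)) →
    ((𝔇.𝒦 Z t).Λ → ℝ) → ℂ)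


/-! ## §3 (S-vertex-T′)ʷ, CENTRED PIECE, from LOCAL growth letters: member minus boxed centre ≤ s₀²·(weight·e^{a₅|Z|}) -/

open Classical in
/-- **THE CENTRED PIECE FOR THE MEMBER FAMILY OF THE DATUM FROM LOCAL GROWTH LETTERS, KERNEL-KEYED** — dag-n10-c `B13Bound226CentredUnscaled` §5
`h226_torus_windowDilated_centred_of_localGrowth_perBond_member` at the datum's kernel record: for the window-dilated member of base point `s₀` (J5's family) and the BOXED CENTRE
(the same boxes, potentials frozen to `𝒪(old,φ;Y,0)`), `‖m(s₀,b) − c(s₀,b)‖ ≤ s₀²·(weight L M c Z a t·e^{a₅|Z|})` for `b ∈ ball 1 ρ_b` — J7b's statement with the exponential-moment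
Taylor letters (`K₁ a₁ K₂ a₂ 𝒱₁ …`) REPLACED by W1-12's local growth vocabulary: the cubic part `𝒲₃` of `𝒲(φ;Y,·)` and the linear part `D𝒪` of `𝒪(old,φ;Y,·)` (measurable,
homogeneous), the local letters (L0)–(L6) and (ℓ1) on the sup-ball `‖A‖ ≤ ρ`, the per-bond multiplicity `m₃`, the evenness of the boxes, the box-support law at `s₀`, `Y`-locality, a
rate `δ > 0` and the two closure inequalities `2δ + 8ρm₃ ≤ a_c`, `hwc` with the capstone's numerics at the centred rate `γ₂ + a_c`.  One application; no estimate proved here.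
[cite: Balaban1988RG2Cluster, (1.34)-(1.36) p.9, Lemma 2 (1.41)-(1.43) p.11, (2.2)-(2.3) p.12, (2.14)-(2.15) p.15, (2.16)-(2.22) p.16, (2.23)-(2.26) p.17, (1.26) p.8; Balaban1987RG1, (2.9)-(2.13) pp.266-268] -/
theorem norm_memberOfDatum_sub_boxedCentre_le_of_localGrowth
    (Z : (domSys P M (k + 1)).Dom) (t : TermLabel P M k L) (old : OlderTerms P 𝔸 M k) (φ : CPair P 𝔸) (s₀ : ℝ)
    (c : B13.Consts)
    (hκ₁ : 1 ≤ c.κ₁)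
    (hα₆ : c.α₆ ≠ 0)
    (hpos : ∀ Y : TDom P.d (L * domCount P M (k + 1)), 0 < invTau c ((tsys P.d (L * domCount P M (k + 1))).dj Y))
    (hhalf : ∀ Y : TDom P.d (L * domCount P M (k + 1)), invTau c ((tsys P.d (L * domCount P M (k + 1))).dj Y) ≤ 1 / 2)
    {Uσ : Set ℂ}
    {Uτ : TDom P.d (L * domCount P M (k + 1)) → Set ℂ}
    (hUσ : IsOpen Uσ)
    (hUτ : ∀ Y, IsOpen (Uτ Y))
    (hUexp : closedBall (0 : ℂ) (Real.exp c.κ₁) ⊆ Uσ)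
    (hUtau : ∀ Y : TDom P.d (L * domCount P M (k + 1)), closedBall (0 : ℂ) ((invTau c ((tsys P.d (L * domCount P M (k + 1))).dj Y))⁻¹) ⊆ Uτ Y)
    (hr : 0 < 𝔇.r)
    (hr' : 𝔇.r ≤ Real.exp c.κ₁ - 1)
    (hsubτ : ∀ Y, ∀ s ∈ Set.uIcc (0 : ℝ) 1, closedBall (s : ℂ) 𝔇.r ⊆ Uτ Y)
    -- the (2.14)-data AT THE REAL COUPLING (b = 1)
    (hχ0 : ∀ B, 0 ≤ χu Z t (s₀ • B))
    (hχc0 : ∀ B, 0 ≤ χcu Z t (s₀ • B))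
    (hχe : ∀ B : (𝔇.𝒦 Z t).Λ → ℝ, χu Z t (s₀ • (-B)) = χu Z t (s₀ • B))
    (hχce : ∀ B, χcu Z t (s₀ • (-B)) = χcu Z t (s₀ • B))
    -- the last line: the coupling-free functions of the unscaled-field law, at the coupling `s`, clipping radius `ρ`
    (𝒲₃ D𝒪 : TDom P.d (L * domCount P M (k + 1)) → ((𝔇.𝒦 Z t).Λ → ℝ) → ℂ)
    {ρ : ℝ}
    (hs : 0 < s₀)
    (hρ : 0 < ρ)
    (h𝒲m : ∀ Y, Measurable (𝒲 Z t φ Y))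
    (h𝒪m : ∀ Y, Measurable (𝒪 Z t old φ Y))
    (h𝒲₃m : ∀ Y, Measurable (𝒲₃ Y))
    (hD𝒪m : ∀ Y, Measurable (D𝒪 Y))
    (h𝒲₃ : ∀ Y (r : ℝ) (A : (𝔇.𝒦 Z t).Λ → ℝ), 𝒲₃ Y (r • A) = (r : ℂ) ^ 3 * 𝒲₃ Y A)
    (hD𝒪 : ∀ Y (r : ℝ) (A : (𝔇.𝒦 Z t).Λ → ℝ), D𝒪 Y (r • A) = (r : ℂ) * D𝒪 Y A)
    (hAhol : ∀ i j, DifferentiableOn ℂ (fun σ => 𝔇.A Z t φ σ i j) {σ | ∀ j, σ j ∈ Uσ})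
    (hχm : Measurable fun B : (𝔇.𝒦 Z t).Λ → ℝ => χu Z t (s₀ • B))
    (hχcm : Measurable fun B : (𝔇.𝒦 Z t).Λ → ℝ => χcu Z t (s₀ • B))
    (hAs : ∀ σ : TPt P.d (domCount P M (k + 1)) → ℂ, (∀ j, σ j ∈ Uσ) → (𝔇.A Z t φ σ).IsSymm)
    (hGhol : ∀ i j, DifferentiableOn ℂ (fun σ => (𝔇.𝒦 Z t).G2 σ (𝔇.uOf Z t φ) i j) {σ | ∀ j, σ j ∈ Uσ})
    -- (2.22)
    {γ₂ rP ac wc δ : ℝ}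
    (qP : ((𝔇.𝒦 Z t).Λ → ℝ) → ℝ)
    (h222 : ∀ B : (𝔇.𝒦 Z t).Λ → ℝ, χu Z t (s₀ • B) * χcu Z t (s₀ • B) ≤ Real.exp (-(γ₂ / 2 * rP ^ 2 * (t.2.card : ℕ)) + γ₂ / 2 * qP B))
    (hγ₂ : 0 ≤ γ₂)
    (hqP : ∀ B, qP B ≤ B ⬝ᵥ B)
    -- the per-domain τ-regions are bounded by R(Y); the LOCAL growth letters (L0)–(L6) on the sup-ball of radius ρ with
    -- constants depending on the domain; any rate δ > 0
    (hδ : 0 < δ)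
    {R c₀ c₃ c₃' c₄ c₁ c₁' c₂ : TDom P.d (L * domCount P M (k + 1)) → ℝ}
    (hR : ∀ Y ∈ t.1, 0 ≤ R Y)
    (hc₃ : ∀ Y ∈ t.1, 0 ≤ c₃ Y)
    (hc₃' : ∀ Y ∈ t.1, 0 ≤ c₃' Y)
    (hc₄ : ∀ Y ∈ t.1, 0 ≤ c₄ Y)
    (hc₁ : ∀ Y ∈ t.1, 0 ≤ c₁ Y)
    (hc₁' : ∀ Y ∈ t.1, 0 ≤ c₁' Y)
    (hc₂ : ∀ Y ∈ t.1, 0 ≤ c₂ Y)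
    (hUτR : ∀ Y ∈ t.1, ∀ z ∈ Uτ Y, ‖z‖ ≤ R Y)
    (h0 : ∀ Y ∈ t.1, ‖𝒪 Z t old φ Y 0‖ ≤ c₀ Y)
    (h1 : ∀ Y ∈ t.1, ∀ A : (𝔇.𝒦 Z t).Λ → ℝ, ‖A‖ ≤ ρ → ‖𝒲 Z t φ Y A‖ ≤ c₃ Y * ‖A‖ ^ 3)
    -- the Y-LOCALISED cubic letter (ℓ1) on the bond supports `S Y` and the PER-BOND multiplicity of the rate weights
    (S : TDom P.d (L * domCount P M (k + 1)) → Finset (𝔇.𝒦 Z t).Λ)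
    (h1loc : ∀ Y ∈ t.1, ∀ A : (𝔇.𝒦 Z t).Λ → ℝ, ‖A‖ ≤ ρ → ‖𝒲 Z t φ Y A‖ ≤ c₃ Y * ‖A‖ * ∑ b ∈ S Y, A b ^ 2)
    {m₃ : ℝ}
    (hm₃0 : 0 ≤ m₃)
    (hm₃ : ∀ bd : (𝔇.𝒦 Z t).Λ, ∑ Y ∈ t.1 with bd ∈ S Y, R Y * c₃ Y ≤ m₃)
    (h2 : ∀ Y ∈ t.1, ∀ A : (𝔇.𝒦 Z t).Λ → ℝ, ‖A‖ ≤ ρ → ‖𝒲 Z t φ Y A - 𝒲₃ Y A‖ ≤ c₄ Y * ‖A‖ ^ 4)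
    (h3 : ∀ Y ∈ t.1, ∀ A : (𝔇.𝒦 Z t).Λ → ℝ, ‖𝒲₃ Y A‖ ≤ c₃' Y * ‖A‖ ^ 3)
    (h4 : ∀ Y ∈ t.1, ∀ A : (𝔇.𝒦 Z t).Λ → ℝ, ‖A‖ ≤ ρ → ‖𝒪 Z t old φ Y A - 𝒪 Z t old φ Y 0‖ ≤ c₁ Y * ‖A‖)
    (h5 : ∀ Y ∈ t.1, ∀ A : (𝔇.𝒦 Z t).Λ → ℝ, ‖A‖ ≤ ρ → ‖𝒪 Z t old φ Y A - 𝒪 Z t old φ Y 0 - D𝒪 Y A‖ ≤ c₂ Y * ‖A‖ ^ 2)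
    (h6 : ∀ Y ∈ t.1, ∀ A : (𝔇.𝒦 Z t).Λ → ℝ, ‖D𝒪 Y A‖ ≤ c₁' Y * ‖A‖)
    -- the BOX-SUPPORT LAW at the coupling and the Y-LOCALITY of the potentials (F214 does not see the clipping)
    (S₀ : Set (𝔇.𝒦 Z t).Λ)
    (hbox : ∀ B : (𝔇.𝒦 Z t).Λ → ℝ, χu Z t (s₀ • B) ≠ 0 → ∀ b ∈ S₀, |(s₀ • B) b| ≤ ρ)
    (hloc𝒲 : ∀ Y ∈ t.1, ∀ A A' : (𝔇.𝒦 Z t).Λ → ℝ, (∀ b ∈ S₀, A b = A' b) → 𝒲 Z t φ Y A = 𝒲 Z t φ Y A')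
    (hloc𝒪 : ∀ Y ∈ t.1, ∀ A A' : (𝔇.𝒦 Z t).Λ → ℝ, (∀ b ∈ S₀, A b = A' b) → 𝒪 Z t old φ Y A = 𝒪 Z t old φ Y A')
    -- ONE rate condition (PER-BOND, volume-free; ×4 for the dilated Wilson part) and the centred constants' letter at the
    -- explicit weighted constants of the DILATED Wilson part (c₃, c₃′, c₄ ↦ 4c₃, 4c₃′, 4c₄)
    (hac : 2 * δ + 8 * ρ * m₃ ≤ ac)
    (hwc : Real.exp (∑ Y ∈ t.1, R Y * c₀ Y)
        * ((∑ Y ∈ t.1, R Y * ((4 * c₄ Y + (4 * c₃ Y + 4 * c₃' Y) / ρ) * (4 / (Real.exp 1 * δ)) ^ 4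
              + (c₂ Y + (c₁ Y + c₁' Y) / ρ) * (2 / (Real.exp 1 * δ)) ^ 2)) * Real.exp (δ / 2)
           + ((∑ Y ∈ t.1, R Y * (4 * c₃ Y * (3 / (Real.exp 1 * δ)) ^ 3 + c₁ Y * (1 / (Real.exp 1 * δ))))
                * Real.exp (δ / 2)) ^ 2
              * Real.exp ((∑ Y ∈ t.1, R Y * (c₀ Y + c₁ Y * ρ)) + ∑ Y ∈ t.1, R Y * c₀ Y))
        ≤ Real.exp wc)
    -- bonds located on the torus `UT Nf`
    (hfibN : ∀ x : UT 𝔇.Nf, (Finset.univ.filter fun j => (𝔇.𝒦 Z t).locN j = x).card ≤ (𝔇.𝒦 Z t).m)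
    -- rates and the letters AT b = 1 (+ K_E)
    {kap kap' kap'' θ θE θΓ θC KG KΓ KCs K₀ KE : ℝ}
    (hkap'' : 0 < kap'')
    (hk1 : kap'' < kap')
    (hk2 : kap' < kap)
    (hθE : 0 ≤ θE)
    (hθΓ : 0 ≤ θΓ)
    (hθC : 0 ≤ θC)
    (hKG : 0 ≤ KG)
    (hKΓ : 0 ≤ KΓ)
    (hKCs : 0 ≤ KCs)
    (hK₀ : 0 ≤ K₀)
    (hKE : 0 ≤ KE)
    (hG : ∀ σ : TPt P.d (domCount P M (k + 1)) → ℂ, (∀ j, σ j ∈ Uσ) →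
      ∀ b j, ‖(𝔇.𝒦 Z t).G2 σ (𝔇.uOf Z t φ) b j‖ ≤ KG * Real.exp (-(kap * tdist1 𝔇.Nf ((𝔇.𝒦 Z t).locΛ b) ((𝔇.𝒦 Z t).locN j))))
    (hΓ₀ : ∀ b j, ‖(𝔇.𝒦 Z t).Γ₀ b j‖ ≤ KΓ * Real.exp (-(kap * tdist1 𝔇.Nf ((𝔇.𝒦 Z t).locΛ b) ((𝔇.𝒦 Z t).locN j))))
    (hCs : ∀ σ : TPt P.d (domCount P M (k + 1)) → ℂ, (∀ j, σ j ∈ Uσ) →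
      ∀ b b', ‖(𝔇.A Z t φ σ)⁻¹ b b'‖ ≤ KCs * Real.exp (-(kap * tdist1 𝔇.Nf ((𝔇.𝒦 Z t).locΛ b) ((𝔇.𝒦 Z t).locΛ b'))))
    (hC216 : ∀ b b', ‖(𝔇.𝒦 Z t).C b b'‖ ≤ K₀ * Real.exp (-(kap * tdist1 𝔇.Nf ((𝔇.𝒦 Z t).locΛ b) ((𝔇.𝒦 Z t).locΛ b'))))
    (hCE : ∀ b b', ‖((𝔇.𝒦 Z t).C⁻¹.map (algebraMap ℝ ℂ)) b b'‖ ≤ KE * Real.exp (-(kap * tdist1 𝔇.Nf ((𝔇.𝒦 Z t).locΛ b) ((𝔇.𝒦 Z t).locΛ b'))))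
    (hdΓ : ∀ σ : TPt P.d (domCount P M (k + 1)) → ℂ, (∀ j, σ j ∈ Uσ) →
      ∀ b j, ‖((𝔇.𝒦 Z t).G2 σ (𝔇.uOf Z t φ) - (𝔇.𝒦 Z t).Γ₀.map (algebraMap ℝ ℂ)) b j‖ ≤ θΓ * Real.exp (-(kap * tdist1 𝔇.Nf ((𝔇.𝒦 Z t).locΛ b) ((𝔇.𝒦 Z t).locN j))))
    (hdC : ∀ σ : TPt P.d (domCount P M (k + 1)) → ℂ, (∀ j, σ j ∈ Uσ) →
      ∀ b b', ‖((𝔇.A Z t φ σ)⁻¹ - (𝔇.𝒦 Z t).C.map (algebraMap ℝ ℂ)) b b'‖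
        ≤ θC * Real.exp (-(kap * tdist1 𝔇.Nf ((𝔇.𝒦 Z t).locΛ b) ((𝔇.𝒦 Z t).locΛ b'))))
    (hdE : ∀ σ : TPt P.d (domCount P M (k + 1)) → ℂ, (∀ j, σ j ∈ Uσ) →
      ∀ b b', ‖(𝔇.A Z t φ σ - (𝔇.𝒦 Z t).C⁻¹.map (algebraMap ℝ ℂ)) b b'‖ ≤ θE * Real.exp (-(kap * tdist1 𝔇.Nf ((𝔇.𝒦 Z t).locΛ b) ((𝔇.𝒦 Z t).locΛ b'))))
    {ρb KG' KCs' θΓ' θC' θE' : ℝ}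
    (hρb1 : ρb < 1)
    (hKG' : (1 + ρb) * KG ≤ KG')
    (hKCs' : ((1 - ρb) ^ 2)⁻¹ * KCs ≤ KCs')
    (hθΓ' : θΓ + ρb * KG ≤ θΓ')
    (hθC' : θC + ρb * (2 + ρb) * ((1 - ρb) ^ 2)⁻¹ * KCs ≤ θC')
    (hθE' : θE + ρb * (2 + ρb) * (θE + KE) ≤ θE')
    -- the capstone's numeric conditions in the primed letters, at the master rate γ₂ + a_c, with w_c
    (hθEle : θE' ≤ θ)
    (hθΓle : θΓ' ≤ θ)
    (hθR1le : ((𝔇.𝒦 Z t).m * (1 + 2 / (kap - kap')) ^ 𝔇.ν) * ((𝔇.𝒦 Z t).m * (1 + 2 / (kap' - kap'')) ^ 𝔇.ν)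
      * (θΓ' * KCs' * KG' + KΓ * θC' * KG' + KΓ * K₀ * θΓ') ≤ θ)
    (hsmallKθ : K₀ * ((𝔇.𝒦 Z t).m * (1 + 2 / kap) ^ 𝔇.ν) * (θ * ((𝔇.𝒦 Z t).m * (1 + 2 / kap'') ^ 𝔇.ν)) < 1)
    {cE g : ℝ}
    (hc0 : 0 ≤ cE)
    (hc : ∀ k, (𝔇.𝒦 Z t).hC.1.eigenvalues k ≤ cE)
    (hαc : (2 * (θ * ((𝔇.𝒦 Z t).m * (1 + 2 / kap'') ^ 𝔇.ν)) + (γ₂ + ac)) * cE ≤ 1 / 2)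
    (hg : 0 ≤ g)
    (hΓq : ∀ X : (𝔇.𝒦 Z t).Λ ⊕ (𝔇.𝒦 Z t).C₀ → ℝ, ((𝔇.𝒦 Z t).Γ₀ *ᵥ X) ⬝ᵥ ((𝔇.𝒦 Z t).C *ᵥ ((𝔇.𝒦 Z t).Γ₀ *ᵥ X)) ≤ g * (X ⬝ᵥ X))
    (hsmall : (2 * (θ * ((𝔇.𝒦 Z t).m * (1 + 2 / kap'') ^ 𝔇.ν)) + (γ₂ + ac)) * (1 + 2 * cE * g) ≤ 1 / 2)
    {a a₅ : ℝ}
    (hPa : a ≤ γ₂ * rP ^ 2)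
    (hvol : 2 * (K₀ * ((𝔇.𝒦 Z t).m * (1 + 2 / kap) ^ 𝔇.ν) * (θ * ((𝔇.𝒦 Z t).m * (1 + 2 / kap'') ^ 𝔇.ν))
              * (1 + (1 - K₀ * ((𝔇.𝒦 Z t).m * (1 + 2 / kap) ^ 𝔇.ν) * (θ * ((𝔇.𝒦 Z t).m * (1 + 2 / kap'') ^ 𝔇.ν)))⁻¹) / 2)
          * (Fintype.card (𝔇.𝒦 Z t).Λ : ℝ)
        + wc + (2 * (θ * ((𝔇.𝒦 Z t).m * (1 + 2 / kap'') ^ 𝔇.ν)) + (γ₂ + ac)) * cE * (Fintype.card (𝔇.𝒦 Z t).Λ : ℝ)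
        + (2 * (θ * ((𝔇.𝒦 Z t).m * (1 + 2 / kap'') ^ 𝔇.ν)) + (γ₂ + ac)) * (1 + 2 * cE * g) * (Fintype.card ((𝔇.𝒦 Z t).Λ ⊕ (𝔇.𝒦 Z t).C₀) : ℝ)
        ≤ a₅ * ((Z.1).card : ℝ))
    {b : ℂ}
    (hb : b ∈ ball (1 : ℂ) ρb) :
    ‖term214 𝔇.r (sigmaList L Z t) (tauList P M k L t)
        (core214 (fun σ => b ^ 2 • 𝔇.A Z t φ σ) (fun σ X => b • 𝔇.Gam Z t φ σ X)
          (F214 t.2.card (fun B => χu Z t (s₀ • B)) (fun B => χcu Z t (s₀ • B)) t.1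
            (fun Y B => b ^ 2 * ((((s₀ : ℝ) : ℂ) ^ 2)⁻¹ * 𝒲 Z t φ Y (s₀ • B)) + 𝒪 Z t old φ Y (s₀ • B)))) 0 0
      - term214 𝔇.r (sigmaList L Z t) (tauList P M k L t)
        (core214 (fun σ => b ^ 2 • 𝔇.A Z t φ σ) (fun σ X => b • 𝔇.Gam Z t φ σ X)
          (F214 t.2.card (fun B => χu Z t (s₀ • B)) (fun B => χcu Z t (s₀ • B)) t.1 (fun Y _ => 𝒪 Z t old φ Y 0))) 0 0‖ ≤
      s₀ ^ 2 * (weight L M c Z a t * Real.exp (a₅ * ((Z.1).card : ℝ))) :=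
  h226_torus_windowDilated_centred_of_localGrowth_perBond_member c hκ₁ hα₆ Z t hpos hhalf hUσ hUτ hUexp hUtau hr hr' hsubτ (sigmaList L Z t) (sigmaList_spec Z t) (tauList P M k L t) (tauList_spec t) (𝔇.A Z t φ) (𝔇.Gam Z t φ) (χY₀ := (fun B => χu Z t (s₀ • B))) (χcP := (fun B => χcu Z t (s₀ • B))) hχ0 hχc0 hχe hχce t.1 (fun Y => 𝒲 Z t φ Y) 𝒲₃ (fun Y => 𝒪 Z t old φ Y) D𝒪 (s := s₀) hs hρ h𝒲m h𝒪m h𝒲₃m hD𝒪m h𝒲₃ hD𝒪 (𝔇.𝒦 Z t).hC (𝔇.𝒦 Z t).Γ₀ hAhol hχm hχcm hAs (fun σ => (𝔇.𝒦 Z t).G2 σ (𝔇.uOf Z t φ)) hGhol (fun _ _ _ => rfl) qP h222 hγ₂ hqP hδ hR hc₃ hc₃' hc₄ hc₁ hc₁' hc₂ hUτR h0 h1 S h1loc hm₃0 hm₃ h2 h3 h4 h5 h6 S₀ hbox hloc𝒲 hloc𝒪 hac hwc (𝔇.𝒦 Z t).locΛ (𝔇.𝒦 Z t).locN (𝔇.𝒦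 Z t).hfib hfibN hkap'' hk1 hk2 hθE hθΓ hθC hKG hKΓ hKCs hK₀ hKE hG hΓ₀ hCs hC216 hCE hdΓ hdC hdE hρb1 hKG' hKCs' hθΓ' hθC' hθE' hθEle hθΓle hθR1le hsmallKθ hc0 hc hαc hg hΓq hsmall hPa hvol hb

/-! ## §4 The large-field members (`P(t) ≠ ∅`) from LOCAL growth letters: the (2.22) surplus in front of the (2.26) weight -/

open Classical in
/-- **THE LARGE-FIELD MEMBERS OF THE DATUM ARE SMALL, FROM LOCAL GROWTH LETTERS, KERNEL-KEYED (`P(t) ≠ ∅`)** — dag-n10-c `B13Term214WindowDilatedUnscaled` §5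
`h226_torus_windowDilated_largeField_of_localGrowth_perBond` at the datum's kernel record: for the window-dilated member of base point `s₀` of a term WITH large-field boxes
(`1 ≤ |P(t)|`), for every `b ∈ ball 1 ρ_b`, `‖m(s₀, b)‖ ≤ e^{−½γ₂(r_P² − r₁²)}·(weight L M c Z a t·e^{a₅|Z|})` — J7a §3's statement with the joint (2.20) letter REPLACED by the local
growth letters of §1 (+ `r₁² ≤ r_P²`, `1 ≤ |P(t)|`, `hPa : a ≤ γ₂r₁²`).  One application; no estimate proved here.
[cite: Balaban1988RG2Cluster, (2.3) p.12, (2.14)-(2.15) p.15, (2.22) p.16, (2.23)-(2.26) p.17, Lemma 2 p.11; Balaban1987RG1, (2.9)-(2.13) pp.266-268] -/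
theorem norm_memberOfDatum_le_largeField_of_localGrowth
    (Z : (domSys P M (k + 1)).Dom) (t : TermLabel P M k L) (old : OlderTerms P 𝔸 M k) (φ : CPair P 𝔸) (s₀ : ℝ)
    (c : B13.Consts)
    (hκ₁ : 1 ≤ c.κ₁)
    (hα₆ : c.α₆ ≠ 0)
    (hpos : ∀ Y : TDom P.d (L * domCount P M (k + 1)), 0 < invTau c ((tsys P.d (L * domCount P M (k + 1))).dj Y))
    (hhalf : ∀ Y : TDom P.d (L * domCount P M (k + 1)), invTau c ((tsys P.d (L * domCount P M (k + 1))).dj Y) ≤ 1 / 2)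
    {Uσ : Set ℂ}
    {Uτ : TDom P.d (L * domCount P M (k + 1)) → Set ℂ}
    (hUσ : IsOpen Uσ)
    (hUτ : ∀ Y, IsOpen (Uτ Y))
    (hUexp : closedBall (0 : ℂ) (Real.exp c.κ₁) ⊆ Uσ)
    (hUtau : ∀ Y : TDom P.d (L * domCount P M (k + 1)), closedBall (0 : ℂ) ((invTau c ((tsys P.d (L * domCount P M (k + 1))).dj Y))⁻¹) ⊆ Uτ Y)
    (hr : 0 < 𝔇.r)
    (hr' : 𝔇.r ≤ Real.exp c.κ₁ - 1)
    (hsubτ : ∀ Y, ∀ s ∈ Set.uIcc (0 : ℝ) 1, closedBall (s : ℂ) 𝔇.r ⊆ Uτ Y)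
    -- the parameter lists of the term: σ over the blocks of Z∖Z′₀, τ over 𝐃
    -- the (2.14)-data of the term AT THE REAL COUPLING (b = 1)
    (hχ0 : ∀ B, 0 ≤ χu Z t (s₀ • B))
    (hχc0 : ∀ B, 0 ≤ χcu Z t (s₀ • B))
    -- the last line: the coupling-free functions of the unscaled-field law, at the coupling `s`, clipping radius `ρ`
    {ρ : ℝ}
    (hs : 0 < s₀)
    (hρ : 0 ≤ ρ)
    (hAhol : ∀ i j, DifferentiableOn ℂ (fun σ => 𝔇.A Z t φ σ i j) {σ | ∀ j, σ j ∈ Uσ})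
    (hχm : Measurable fun B : (𝔇.𝒦 Z t).Λ → ℝ => χu Z t (s₀ • B))
    (hχcm : Measurable fun B : (𝔇.𝒦 Z t).Λ → ℝ => χcu Z t (s₀ • B))
    (h𝒲m : ∀ Y, Measurable (𝒲 Z t φ Y))
    (h𝒪m : ∀ Y, Measurable (𝒪 Z t old φ Y))
    (hAs : ∀ σ : TPt P.d (domCount P M (k + 1)) → ℂ, (∀ j, σ j ∈ Uσ) → (𝔇.A Z t φ σ).IsSymm)
    -- the Γ-operator is linear with kernel G(σ), entrywise holomorphic
    (hGhol : ∀ i j, DifferentiableOn ℂ (fun σ => (𝔇.𝒦 Z t).G2 σ (𝔇.uOf Z t φ) i j) {σ | ∀ j, σ j ∈ Uσ})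
    -- (2.22) at radius r_P with |P| ≥ 1, and a smaller radius r₁
    {γ₂ rP r₁ : ℝ}
    (qP : ((𝔇.𝒦 Z t).Λ → ℝ) → ℝ)
    (h222 : ∀ B : (𝔇.𝒦 Z t).Λ → ℝ, χu Z t (s₀ • B) * χcu Z t (s₀ • B) ≤ Real.exp (-(γ₂ / 2 * rP ^ 2 * (t.2.card : ℕ)) + γ₂ / 2 * qP B))
    (hγ₂ : 0 ≤ γ₂)
    (hqP : ∀ B, qP B ≤ B ⬝ᵥ B)
    (hr₁ : r₁ ^ 2 ≤ rP ^ 2)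
    (hP1 : 1 ≤ t.2.card)
    -- in place of the joint (2.20) letter: per-domain τ-radii `R(Y)`, the LOCAL letters (L0), (ℓ1), (L4) on the sup-ball of
    -- radius `ρ` with constants depending on the domain, bond supports `S Y`, the PER-BOND multiplicity `m₃`, the box-support
    -- law at the coupling and the `Y`-locality of the potentials
    {R c₀ c₁ c₃ : TDom P.d (L * domCount P M (k + 1)) → ℝ}
    (hR : ∀ Y ∈ t.1, 0 ≤ R Y)
    (hc₃ : ∀ Y ∈ t.1, 0 ≤ c₃ Y)
    (hc₁ : ∀ Y ∈ t.1, 0 ≤ c₁ Y)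
    (hUτR : ∀ Y ∈ t.1, ∀ z ∈ Uτ Y, ‖z‖ ≤ R Y)
    (h0 : ∀ Y ∈ t.1, ‖𝒪 Z t old φ Y 0‖ ≤ c₀ Y)
    (S : TDom P.d (L * domCount P M (k + 1)) → Finset (𝔇.𝒦 Z t).Λ)
    (h1loc : ∀ Y ∈ t.1, ∀ A : (𝔇.𝒦 Z t).Λ → ℝ, ‖A‖ ≤ ρ → ‖𝒲 Z t φ Y A‖ ≤ c₃ Y * ‖A‖ * ∑ b ∈ S Y, A b ^ 2)
    (h4 : ∀ Y ∈ t.1, ∀ A : (𝔇.𝒦 Z t).Λ → ℝ, ‖A‖ ≤ ρ → ‖𝒪 Z t old φ Y A - 𝒪 Z t old φ Y 0‖ ≤ c₁ Y * ‖A‖)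
    {m₃ : ℝ}
    (hm₃0 : 0 ≤ m₃)
    (hm₃ : ∀ bd : (𝔇.𝒦 Z t).Λ, ∑ Y ∈ t.1 with bd ∈ S Y, R Y * c₃ Y ≤ m₃)
    (S₀ : Set (𝔇.𝒦 Z t).Λ)
    (hbox : ∀ B : (𝔇.𝒦 Z t).Λ → ℝ, χu Z t (s₀ • B) ≠ 0 → ∀ b ∈ S₀, |(s₀ • B) b| ≤ ρ)
    (hloc𝒲 : ∀ Y ∈ t.1, ∀ A A' : (𝔇.𝒦 Z t).Λ → ℝ, (∀ b ∈ S₀, A b = A' b) → 𝒲 Z t φ Y A = 𝒲 Z t φ Y A')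
    (hloc𝒪 : ∀ Y ∈ t.1, ∀ A A' : (𝔇.𝒦 Z t).Λ → ℝ, (∀ b ∈ S₀, A b = A' b) → 𝒪 Z t old φ Y A = 𝒪 Z t old φ Y A')
    -- bonds located on the torus `UT Nf`
    (hfibN : ∀ x : UT 𝔇.Nf, (Finset.univ.filter fun j => (𝔇.𝒦 Z t).locN j = x).card ≤ (𝔇.𝒦 Z t).m)
    -- rates and the letters AT b = 1 (+ K_E)
    {kap kap' kap'' θ θE θΓ θC KG KΓ KCs K₀ KE : ℝ}
    (hkap'' : 0 < kap'')
    (h1 : kap'' < kap')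
    (h2 : kap' < kap)
    (hθE : 0 ≤ θE)
    (hθΓ : 0 ≤ θΓ)
    (hθC : 0 ≤ θC)
    (hKG : 0 ≤ KG)
    (hKΓ : 0 ≤ KΓ)
    (hKCs : 0 ≤ KCs)
    (hK₀ : 0 ≤ K₀)
    (hKE : 0 ≤ KE)
    (hG : ∀ σ : TPt P.d (domCount P M (k + 1)) → ℂ, (∀ j, σ j ∈ Uσ) →
      ∀ b j, ‖(𝔇.𝒦 Z t).G2 σ (𝔇.uOf Z t φ) b j‖ ≤ KG * Real.exp (-(kap * tdist1 𝔇.Nf ((𝔇.𝒦 Z t).locΛ b) ((𝔇.𝒦 Z t).locN j))))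
    (hΓ₀ : ∀ b j, ‖(𝔇.𝒦 Z t).Γ₀ b j‖ ≤ KΓ * Real.exp (-(kap * tdist1 𝔇.Nf ((𝔇.𝒦 Z t).locΛ b) ((𝔇.𝒦 Z t).locN j))))
    (hCs : ∀ σ : TPt P.d (domCount P M (k + 1)) → ℂ, (∀ j, σ j ∈ Uσ) →
      ∀ b b', ‖(𝔇.A Z t φ σ)⁻¹ b b'‖ ≤ KCs * Real.exp (-(kap * tdist1 𝔇.Nf ((𝔇.𝒦 Z t).locΛ b) ((𝔇.𝒦 Z t).locΛ b'))))
    (hC216 : ∀ b b', ‖(𝔇.𝒦 Z t).C b b'‖ ≤ K₀ * Real.exp (-(kap * tdist1 𝔇.Nf ((𝔇.𝒦 Z t).locΛ b) ((𝔇.𝒦 Z t).locΛ b'))))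
    (hCE : ∀ b b', ‖((𝔇.𝒦 Z t).C⁻¹.map (algebraMap ℝ ℂ)) b b'‖ ≤ KE * Real.exp (-(kap * tdist1 𝔇.Nf ((𝔇.𝒦 Z t).locΛ b) ((𝔇.𝒦 Z t).locΛ b'))))
    (hdΓ : ∀ σ : TPt P.d (domCount P M (k + 1)) → ℂ, (∀ j, σ j ∈ Uσ) →
      ∀ b j, ‖((𝔇.𝒦 Z t).G2 σ (𝔇.uOf Z t φ) - (𝔇.𝒦 Z t).Γ₀.map (algebraMap ℝ ℂ)) b j‖ ≤ θΓ * Real.exp (-(kap * tdist1 𝔇.Nf ((𝔇.𝒦 Z t).locΛ b) ((𝔇.𝒦 Z t).locN j))))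
    (hdC : ∀ σ : TPt P.d (domCount P M (k + 1)) → ℂ, (∀ j, σ j ∈ Uσ) →
      ∀ b b', ‖((𝔇.A Z t φ σ)⁻¹ - (𝔇.𝒦 Z t).C.map (algebraMap ℝ ℂ)) b b'‖
        ≤ θC * Real.exp (-(kap * tdist1 𝔇.Nf ((𝔇.𝒦 Z t).locΛ b) ((𝔇.𝒦 Z t).locΛ b'))))
    (hdE : ∀ σ : TPt P.d (domCount P M (k + 1)) → ℂ, (∀ j, σ j ∈ Uσ) →
      ∀ b b', ‖(𝔇.A Z t φ σ - (𝔇.𝒦 Z t).C⁻¹.map (algebraMap ℝ ℂ)) b b'‖ ≤ θE * Real.exp (-(kap * tdist1 𝔇.Nf ((𝔇.𝒦 Z t).locΛ b) ((𝔇.𝒦 Z t).locΛ b'))))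
    -- the radius of the ball in `b` and the PRIMED letters dominating the §2 transports
    {ρb KG' KCs' θΓ' θC' θE' a' w' : ℝ}
    (hρb1 : ρb < 1)
    (hKG' : (1 + ρb) * KG ≤ KG')
    (hKCs' : ((1 - ρb) ^ 2)⁻¹ * KCs ≤ KCs')
    (hθΓ' : θΓ + ρb * KG ≤ θΓ')
    (hθC' : θC + ρb * (2 + ρb) * ((1 - ρb) ^ 2)⁻¹ * KCs ≤ θC')
    (hθE' : θE + ρb * (2 + ρb) * (θE + KE) ≤ θE')
    (ha' : (1 + ρb) ^ 2 * (2 * ρ * m₃) ≤ a')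
    (hw' : (1 + ρb) ^ 2 * (∑ Y ∈ t.1, R Y * (c₀ Y + c₁ Y * ρ)) ≤ w')
    -- the capstone's numeric conditions in the primed letters
    (hθEle : θE' ≤ θ)
    (hθΓle : θΓ' ≤ θ)
    (hθR1le : ((𝔇.𝒦 Z t).m * (1 + 2 / (kap - kap')) ^ 𝔇.ν) * ((𝔇.𝒦 Z t).m * (1 + 2 / (kap' - kap'')) ^ 𝔇.ν)
      * (θΓ' * KCs' * KG' + KΓ * θC' * KG' + KΓ * K₀ * θΓ') ≤ θ)
    (hsmallKθ : K₀ * ((𝔇.𝒦 Z t).m * (1 + 2 / kap) ^ 𝔇.ν) * (θ * ((𝔇.𝒦 Z t).m * (1 + 2 / kap'') ^ 𝔇.ν)) < 1)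
    {cE g : ℝ}
    (hc0 : 0 ≤ cE)
    (hc : ∀ k, (𝔇.𝒦 Z t).hC.1.eigenvalues k ≤ cE)
    (hαc : (2 * (θ * ((𝔇.𝒦 Z t).m * (1 + 2 / kap'') ^ 𝔇.ν)) + (γ₂ + a')) * cE ≤ 1 / 2)
    (hg : 0 ≤ g)
    (hΓq : ∀ X : (𝔇.𝒦 Z t).Λ ⊕ (𝔇.𝒦 Z t).C₀ → ℝ, ((𝔇.𝒦 Z t).Γ₀ *ᵥ X) ⬝ᵥ ((𝔇.𝒦 Z t).C *ᵥ ((𝔇.𝒦 Z t).Γ₀ *ᵥ X)) ≤ g * (X ⬝ᵥ X))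
    (hsmall : (2 * (θ * ((𝔇.𝒦 Z t).m * (1 + 2 / kap'') ^ 𝔇.ν)) + (γ₂ + a')) * (1 + 2 * cE * g) ≤ 1 / 2)
    -- constant matching, p. 17, in the primed letters, at the SMALLER radius r₁
    {a a₅ : ℝ}
    (hPa : a ≤ γ₂ * r₁ ^ 2)
    (hvol : 2 * (K₀ * ((𝔇.𝒦 Z t).m * (1 + 2 / kap) ^ 𝔇.ν) * (θ * ((𝔇.𝒦 Z t).m * (1 + 2 / kap'') ^ 𝔇.ν))
              * (1 + (1 - K₀ * ((𝔇.𝒦 Z t).m * (1 + 2 / kap) ^ 𝔇.ν) * (θ * ((𝔇.𝒦 Z t).m * (1 + 2 / kap'') ^ 𝔇.ν)))⁻¹) / 2)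
          * (Fintype.card (𝔇.𝒦 Z t).Λ : ℝ)
        + w' + (2 * (θ * ((𝔇.𝒦 Z t).m * (1 + 2 / kap'') ^ 𝔇.ν)) + (γ₂ + a')) * cE * (Fintype.card (𝔇.𝒦 Z t).Λ : ℝ)
        + (2 * (θ * ((𝔇.𝒦 Z t).m * (1 + 2 / kap'') ^ 𝔇.ν)) + (γ₂ + a')) * (1 + 2 * cE * g) * (Fintype.card ((𝔇.𝒦 Z t).Λ ⊕ (𝔇.𝒦 Z t).C₀) : ℝ)
        ≤ a₅ * ((Z.1).card : ℝ)) :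
    ∀ b ∈ ball (1 : ℂ) ρb, ‖term214 𝔇.r (sigmaList L Z t) (tauList P M k L t)
        (core214 (fun σ => b ^ 2 • 𝔇.A Z t φ σ) (fun σ X => b • 𝔇.Gam Z t φ σ X)
          (F214 t.2.card (fun B => χu Z t (s₀ • B)) (fun B => χcu Z t (s₀ • B)) t.1
            (fun Y B => b ^ 2 * ((((s₀ : ℝ) : ℂ) ^ 2)⁻¹ * 𝒲 Z t φ Y (s₀ • B)) + 𝒪 Z t old φ Y (s₀ • B)))) 0 0‖ ≤
      Real.exp (-(γ₂ / 2 * (rP ^ 2 - r₁ ^ 2))) * (weight L M c Z a t * Real.exp (a₅ * ((Z.1).card : ℝ))) :=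
  h226_torus_windowDilated_largeField_of_localGrowth_perBond c hκ₁ hα₆ Z t hpos hhalf hUσ hUτ hUexp hUtau hr hr' hsubτ (sigmaList L Z t) (sigmaList_spec Z t) (tauList P M k L t) (tauList_spec t) (𝔇.A Z t φ) (𝔇.Gam Z t φ) (fun B => χu Z t (s₀ • B)) (fun B => χcu Z t (s₀ • B)) hχ0 hχc0 t.1 (fun Y => 𝒲 Z t φ Y) (fun Y => 𝒪 Z t old φ Y) (s := s₀) hs hρ (𝔇.𝒦 Z t).hC (𝔇.𝒦 Z t).Γ₀ hAhol hχm hχcm h𝒲m h𝒪m hAs (fun σ => (𝔇.𝒦 Z t).G2 σ (𝔇.uOf Z t φ)) hGhol (fun _ _ _ => rfl) qP h222 hγ₂ hqP hr₁ hP1 hR hc₃ hc₁ hUτR h0 S h1loc h4 hm₃0 hm₃ S₀ hbox hloc𝒲 hloc𝒪 (𝔇.𝒦 Z t).locΛ (𝔇.𝒦 Z t).locN (𝔇.𝒦 Z t).hfib hfibN hkap'' h1 h2 hθE hθΓ hθC hKG hKΓ hKCs hK₀ hKE hG hΓ₀ hCs hC216 hCE hdΓ hdC hdE hρb1 hKG'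 hKCs' hθΓ' hθC' hθE' ha' hw' hθEle hθΓle hθR1le hsmallKθ hc0 hc hαc hg hΓq hsmall hPa hvol

end YMDAG.N22.W1

end
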